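import Mathlib
import HarnessLib

/-!
# Stub `stub_poissonIntegral` of line `Sketch` (crux `stmt-QuantumFields-8760`)

Route `EquipartitionCriticality` of `YangMills`, crux item `stmt-QuantumFields-8760`
(`Summit.QuantumFields.YangMills.Theses.EquipartitionCriticality.EquipartitionPinsProbe`), line
`Sketch`.

What is proved: the classical Poisson-kernel integral
`∫_{-π}^{π} cos(nθ)/(a − cos θ) dθ = 2π (a − √(a²−1))ⁿ / √(a²−1)` for real `a > 1` and `n : ℕ`
(the one-dimensional core of the mixed time/momentum representation of the axis Green function;
`r = a − √(a²−1) ∈ (0,1)` is `e^{−ω}` with `cosh ω = a`).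

Proof (elementary real analysis, Mathlib only; no auxiliary definitions). Write `u n` for the
integral and put `d := √(a²−1)`, so that `(a − d)(a + d) = 1` and `1 < a + d`.
* `u 1 = a u 0 − 2π`, from `cos θ/(a − cos θ) = a/(a − cos θ) − 1` (`integral_one`);
* `u (n+2) + u n = 2a u (n+1)`, from `cos((n+2)θ) + cos(nθ) = 2 cos((n+1)θ) cos θ` and
  `∫_{-π}^{π} cos(mθ) dθ = 0` for `m ≥ 1` (`integral_rec`);
* `|u n| ≤ (1/(a−1)) · 2π` uniformly in `n` (`abs_integral_le`).
The rest is algebra of bounded solutions of the recurrence (`rec_factor`, `rec_pow`,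
`growing_mode_zero`, `succ_eq_mul`, `closed_form`): `D n := u (n+1) − (a − d) u n` satisfies
`D (n+1) = (a + d) D n`, so `D n = (a + d)ⁿ D 0`; boundedness and `a + d > 1` force `D 0 = 0`, i.e.
`u (n+1) = (a − d) u n`; finally `(a − d) u 0 = u 1 = a u 0 − 2π` gives `u 0 = 2π/d` and
`u n = 2π (a − d)ⁿ / d`.
-/

noncomputable section

namespace Summit.QuantumFields.YangMills.Theorems.EquipartitionPinsProbe

namespace PoissonIntegral

open Real intervalIntegral MeasureTheory

/-! ### Bounded solutions of `u (n+2) + u n = 2a · u (n+1)` -/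

/-- One step of the growing mode: with `d² = a² − 1`,
`u (n+2) − (a − d) u (n+1) = (a + d) (u (n+1) − (a − d) u n)`. -/
theorem rec_factor {a d : ℝ} (hd : d ^ 2 = a ^ 2 - 1) {u : ℕ → ℝ}
    (hrec : ∀ n, u (n + 2) + u n = 2 * a * u (n + 1)) (n : ℕ) :
    u (n + 2) - (a - d) * u (n + 1) = (a + d) * (u (n + 1) - (a - d) * u n) := by
  linear_combination hrec n - u n * hd

/-- The growing mode is geometric: `u (n+1) − (a − d) u n = (a + d)ⁿ (u 1 − (a − d) u 0)`. -/
theorem rec_pow {a d : ℝ} (hd : d ^ 2 = a ^ 2 - 1) {u : ℕ → ℝ}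
    (hrec : ∀ n, u (n + 2) + u n = 2 * a * u (n + 1)) (n : ℕ) :
    u (n + 1) - (a - d) * u n = (a + d) ^ n * (u 1 - (a - d) * u 0) := by
  induction n with
  | zero => simp
  | succ k ih =>
    have h := rec_factor hd hrec k
    rw [ih] at h
    have e : u (k + 1 + 1) = u (k + 2) := rfl
    rw [e, pow_succ]
    linear_combination h

/-- Boundedness kills the growing mode: if `|u n| ≤ M` for all `n` and `a + d > 1`, then
`u 1 = (a − d) u 0`. -/
theorem growing_mode_zero {a d M : ℝ} (hd : d ^ 2 = a ^ 2 - 1) (hs : 1 < a + d) {u : ℕ → ℝ}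
    (hrec : ∀ n, u (n + 2) + u n = 2 * a * u (n + 1)) (hbound : ∀ n, |u n| ≤ M) :
    u 1 = (a - d) * u 0 := by
  have hs0 : 0 ≤ a + d := le_of_lt (lt_trans zero_lt_one hs)
  have hD : ∀ n : ℕ, (a + d) ^ n * |u 1 - (a - d) * u 0| ≤ M + |a - d| * M := by
    intro n
    calc (a + d) ^ n * |u 1 - (a - d) * u 0| = |u (n + 1) - (a - d) * u n| := by
          rw [rec_pow hd hrec n, abs_mul, abs_of_nonneg (pow_nonneg hs0 n)]
      _ ≤ |u (n + 1)| + |(a - d) * u n| := abs_sub _ _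
      _ = |u (n + 1)| + |a - d| * |u n| := by rw [abs_mul]
      _ ≤ M + |a - d| * M :=
          add_le_add (hbound _) (mul_le_mul_of_nonneg_left (hbound _) (abs_nonneg _))
  by_contra hne
  have hpos : 0 < |u 1 - (a - d) * u 0| := abs_pos.mpr (sub_ne_zero.mpr hne)
  obtain ⟨n, hn⟩ := pow_unbounded_of_one_lt ((M + |a - d| * M) / |u 1 - (a - d) * u 0|) hs
  rw [div_lt_iff₀ hpos] at hn
  have := hD n
  linarith

/-- Hence a bounded solution decays geometrically: `u (n+1) = (a − d) u n`. -/
theorem succ_eq_mul {a d M : ℝ} (hd : d ^ 2 = a ^ 2 - 1) (hs : 1 < a + d) {u : ℕ → ℝ}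
    (hrec : ∀ n, u (n + 2) + u n = 2 * a * u (n + 1)) (hbound : ∀ n, |u n| ≤ M) (n : ℕ) :
    u (n + 1) = (a - d) * u n := by
  have h := rec_pow hd hrec n
  rw [growing_mode_zero hd hs hrec hbound, sub_self, mul_zero, sub_eq_zero] at h
  exact h

/-- Closed form of a bounded solution with `u 1 = a u 0 − c`: `u n = c (a − d)ⁿ / d`. -/
theorem closed_form {a d M c : ℝ} (hd : d ^ 2 = a ^ 2 - 1) (hd0 : 0 < d) (hs : 1 < a + d)
    {u : ℕ → ℝ} (hrec : ∀ n, u (n + 2) + u n = 2 * a * u (n + 1)) (hbound : ∀ n, |u n| ≤ M)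
    (h1 : u 1 = a * u 0 - c) (n : ℕ) : u n = c * (a - d) ^ n / d := by
  have h2 := succ_eq_mul hd hs hrec hbound
  have h0 : u 0 = c / d := by
    have h3 : d * u 0 = c := by linear_combination h2 0 - h1
    rw [eq_div_iff hd0.ne']
    linarith
  induction n with
  | zero => rw [h0, pow_zero, mul_one]
  | succ k ih => rw [h2 k, ih]; ring

/-! ### The integrals -/

/-- The denominator `a − cos θ` is at least `a − 1`. -/
theorem sub_one_le_denom (a θ : ℝ) : a - 1 ≤ a - Real.cos θ := by
  have := Real.cos_le_one θ
  linarith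

/-- For `a > 1` the denominator `a − cos θ` is positive. -/
theorem denom_pos {a : ℝ} (ha : 1 < a) (θ : ℝ) : 0 < a - Real.cos θ :=
  lt_of_lt_of_le (by linarith) (sub_one_le_denom a θ)

/-- The integrand `cos(nθ)/(a − cos θ)` is continuous in `θ`. -/
theorem continuous_integrand {a : ℝ} (ha : 1 < a) (n : ℕ) :
    Continuous fun θ : ℝ => Real.cos (n * θ) / (a - Real.cos θ) :=
  Continuous.div (by fun_prop) (by fun_prop) fun θ => (denom_pos ha θ).ne'

/-- The integrand is interval integrable on any interval. -/
theorem intervalIntegrable_integrand {a : ℝ} (ha : 1 < a) (n : ℕ) (b c : ℝ) :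
    IntervalIntegrable (fun θ : ℝ => Real.cos (n * θ) / (a - Real.cos θ)) volume b c :=
  (continuous_integrand ha n).intervalIntegrable b c

/-- Uniform bound on the integrand: `|cos(nθ)/(a − cos θ)| ≤ 1/(a − 1)`. -/
theorem abs_integrand_le {a : ℝ} (ha : 1 < a) (n : ℕ) (θ : ℝ) :
    |Real.cos (n * θ) / (a - Real.cos θ)| ≤ 1 / (a - 1) := by
  rw [abs_div, abs_of_pos (denom_pos ha θ)]
  exact div_le_div₀ zero_le_one (Real.abs_cos_le_one _) (by linarith) (sub_one_le_denom a θ)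

/-- Uniform bound on the integrals: `|∫_{-π}^{π} cos(nθ)/(a − cos θ) dθ| ≤ (1/(a−1)) · |π − (−π)|`.
-/
theorem abs_integral_le {a : ℝ} (ha : 1 < a) (n : ℕ) :
    |∫ θ in (-π)..π, Real.cos (n * θ) / (a - Real.cos θ)| ≤ 1 / (a - 1) * |π - -π| := by
  have h := intervalIntegral.norm_integral_le_of_norm_le_const (a := -π) (b := π)
    (C := 1 / (a - 1)) (f := fun θ : ℝ => Real.cos (n * θ) / (a - Real.cos θ)) fun x _ => by
      rw [Real.norm_eq_abs]
      exact abs_integrand_le ha n x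
  rw [Real.norm_eq_abs] at h
  exact h

/-- `∫_{-π}^{π} cos(mθ) dθ = 0` for a positive integer `m`. -/
theorem integral_cos_nat_mul {m : ℕ} (hm : m ≠ 0) : ∫ θ in (-π)..π, Real.cos (m * θ) = 0 := by
  have hc : (m : ℝ) ≠ 0 := Nat.cast_ne_zero.mpr hm
  rw [intervalIntegral.integral_comp_mul_left Real.cos hc, integral_cos]
  simp [mul_neg, Real.sin_neg, Real.sin_nat_mul_pi]

/-- Pointwise identity behind `u 1 = a u 0 − 2π`: `cos θ/(a − cos θ) = a/(a − cos θ) − 1`. -/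
theorem integrand_one {a : ℝ} (ha : 1 < a) (θ : ℝ) :
    Real.cos ((1 : ℕ) * θ) / (a - Real.cos θ) =
      a * (Real.cos ((0 : ℕ) * θ) / (a - Real.cos θ)) - 1 := by
  have hd := (denom_pos ha θ).ne'
  simp only [Nat.cast_one, one_mul, Nat.cast_zero, zero_mul, Real.cos_zero]
  field_simp
  ring

/-- Pointwise identity behind the three-term recurrence:
`cos((n+2)θ)/(a − cos θ) + cos(nθ)/(a − cos θ) = 2a cos((n+1)θ)/(a − cos θ) − 2cos((n+1)θ)`. -/
theorem integrand_rec {a : ℝ} (ha : 1 < a) (n : ℕ) (θ : ℝ) :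
    Real.cos ((n + 2 : ℕ) * θ) / (a - Real.cos θ) + Real.cos (n * θ) / (a - Real.cos θ) =
      2 * a * (Real.cos ((n + 1 : ℕ) * θ) / (a - Real.cos θ)) -
        2 * Real.cos ((n + 1 : ℕ) * θ) := by
  have hd := (denom_pos ha θ).ne'
  have h1 : Real.cos ((n + 2 : ℕ) * θ) = Real.cos ((n + 1 : ℕ) * θ + θ) := by
    congr 1; push_cast; ring
  have h2 : Real.cos (n * θ) = Real.cos ((n + 1 : ℕ) * θ - θ) := by
    congr 1; push_cast; ring
  rw [h1, h2, Real.cos_add, Real.cos_sub]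
  field_simp
  ring

/-- First relation: `u 1 = a u 0 − 2π`. -/
theorem integral_one {a : ℝ} (ha : 1 < a) :
    ∫ θ in (-π)..π, Real.cos ((1 : ℕ) * θ) / (a - Real.cos θ) =
      a * (∫ θ in (-π)..π, Real.cos ((0 : ℕ) * θ) / (a - Real.cos θ)) - 2 * π := by
  have h : (∫ θ in (-π)..π, Real.cos ((1 : ℕ) * θ) / (a - Real.cos θ)) =
      ∫ θ in (-π)..π, (a * (Real.cos ((0 : ℕ) * θ) / (a - Real.cos θ)) - 1) := by
    congr 1
    funext θ
    exact integrand_one ha θ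
  have hf : IntervalIntegrable (fun θ : ℝ => a * (Real.cos ((0 : ℕ) * θ) / (a - Real.cos θ)))
      volume (-π) π :=
    (intervalIntegrable_integrand ha 0 _ _).const_mul a
  have hg : IntervalIntegrable (fun _ : ℝ => (1 : ℝ)) volume (-π) π := intervalIntegrable_const
  rw [h, intervalIntegral.integral_sub hf hg, intervalIntegral.integral_const_mul,
    intervalIntegral.integral_const]
  simp only [smul_eq_mul, mul_one]
  ring

/-- Three-term recurrence: `u (n+2) + u n = 2a · u (n+1)`. -/
theorem integral_rec {a : ℝ} (ha : 1 < a) (n : ℕ) :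
    (∫ θ in (-π)..π, Real.cos ((n + 2 : ℕ) * θ) / (a - Real.cos θ)) +
        (∫ θ in (-π)..π, Real.cos (n * θ) / (a - Real.cos θ)) =
      2 * a * ∫ θ in (-π)..π, Real.cos ((n + 1 : ℕ) * θ) / (a - Real.cos θ) := by
  have hf2 : IntervalIntegrable (fun θ : ℝ => Real.cos ((n + 2 : ℕ) * θ) / (a - Real.cos θ))
      volume (-π) π := intervalIntegrable_integrand ha _ _ _
  have hf0 : IntervalIntegrable (fun θ : ℝ => Real.cos (n * θ) / (a - Real.cos θ))
      volume (-π) π := intervalIntegrable_integrand ha _ _ _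
  have h2 : ∫ θ in (-π)..π, (Real.cos ((n + 2 : ℕ) * θ) / (a - Real.cos θ) +
        Real.cos (n * θ) / (a - Real.cos θ)) =
      ∫ θ in (-π)..π, (2 * a * (Real.cos ((n + 1 : ℕ) * θ) / (a - Real.cos θ)) -
        2 * Real.cos ((n + 1 : ℕ) * θ)) := by
    congr 1
    funext θ
    exact integrand_rec ha n θ
  have hf : IntervalIntegrable
      (fun θ : ℝ => 2 * a * (Real.cos ((n + 1 : ℕ) * θ) / (a - Real.cos θ))) volume (-π) π :=
    (intervalIntegrable_integrand ha _ _ _).const_mul _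
  have hg : IntervalIntegrable (fun θ : ℝ => 2 * Real.cos ((n + 1 : ℕ) * θ)) volume (-π) π :=
    Continuous.intervalIntegrable (by fun_prop) _ _
  rw [← intervalIntegral.integral_add hf2 hf0, h2, intervalIntegral.integral_sub hf hg,
    intervalIntegral.integral_const_mul, intervalIntegral.integral_const_mul,
    integral_cos_nat_mul (Nat.succ_ne_zero n)]
  ring

end PoissonIntegral

/-- The Poisson-kernel integral: for real `a > 1` and `n : ℕ`,
`∫_{-π}^{π} cos(nθ)/(a − cos θ) dθ = 2π (a − √(a²−1))ⁿ / √(a²−1)`. -/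
theorem stub_poissonIntegral :
    ∀ a : ℝ, 1 < a → ∀ n : ℕ,
      ∫ θ in (-Real.pi)..Real.pi, Real.cos (n * θ) / (a - Real.cos θ) =
        2 * Real.pi * (a - Real.sqrt (a ^ 2 - 1)) ^ n / Real.sqrt (a ^ 2 - 1) := by
  intro a ha n
  have hd0 : 0 < Real.sqrt (a ^ 2 - 1) := Real.sqrt_pos.mpr (by nlinarith)
  have hdsq : Real.sqrt (a ^ 2 - 1) ^ 2 = a ^ 2 - 1 := Real.sq_sqrt (by nlinarith)
  exact PoissonIntegral.closed_form hdsq hd0 (by linarith)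
    (u := fun m : ℕ => ∫ θ in (-Real.pi)..Real.pi, Real.cos (m * θ) / (a - Real.cos θ))
    (fun m => PoissonIntegral.integral_rec ha m) (fun m => PoissonIntegral.abs_integral_le ha m)
    (PoissonIntegral.integral_one ha) n

end Summit.QuantumFields.YangMills.Theorems.EquipartitionPinsProbe
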